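import Summits.CriticalPhenomena.PercolationContinuityZ3.Theorems.PercNearOneGluingNoHeavyLowerTailSahiRecursionCert
import Summits.CriticalPhenomena.PercolationContinuityZ3.Theorems.PercNearOneGluingNoHeavyLowerTailSahiC3CubeColourCheck

/-!
# Sahi's `E_n` on the cube `{0,1}^m`, every order: a MEMOISED Lieb–Sahi recursion on Kronecker numbers (block families), and the
# resulting faster digit test `testM` — same number as `NCopyCert.checkFamW`, hence the same soundness

Support file (cell `prim-sahi`, seat `prim-sahi-typer` gen 29; `--supports stmt-CriticalPhenomena-4575`).  Computable definitions + pure proofs,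
standard axioms, no `sorry`; nothing evaluated here.

`NCopyCert.sahiKr KT F n a` runs the Lieb–Sahi recursion `E_{n+2}(f; g) = F·Σ_i E_{n+1}(g, g_i ↦ g_i ∧ f) − E_{n+1}(g)·KT(f)` literally: about
`e·n!` calls and as many Kronecker numbers `KT` built on the fly (`n = 7`: `7 240` calls).  Every family met is a family of INTERSECTIONS OF
BLOCKS of the original members, i.e. is described by a list of disjoint index sets ("block family"); distinct block families are far fewer
(`Σ_j (n+1−j)^j`, `n = 7`: `733`).  This file

* tabulates the Kronecker numbers of all `2^n − 1` intersections once (`andMaskF`, `kTable`);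
* runs the recursion on block families (`mergeAt`, `krRec` — provably the same number: `krRec_eq_sahiKr`) with a cache of the values of the
  block families already met (`krMemo`, a `Std.HashMap`; `krMemo_eq` — the cache only ever holds correct values);
* `testM m n σb` — the digit test on that number; **`testM_sound`**: a passing test gives `E_n(μ_p; A) ≥ 0` for every product weight (through
  `NCopyCert.sahiE_ind_nonneg_of_checkFamW`), the leaf-test hypothesis of `SahiSymCube.sahiPositive_of_symCheckT`.
Measured on the farm (m = 5): order 6 ≈ 0.4 s/test (plain ≈ 0.8 s), order 7 ≈ 2.6 s/test (plain ≈ 20 s). [this work]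
-/

namespace Summit.CriticalPhenomena.PercolationContinuityZ3.Theorems.SahiSymCube

open Finset OneCutCert CovTransferCert SahiC3Cube NCopyCert
open Literature.Combinatorics.Sahi2008 (sahiE bernoulliWeight)
open Literature.Probability.Percolation.DecisionTree (ind)

/-! ## Intersections of blocks of members -/

/-- `full ∧ ⋀_{i ∈ s} a[i]`: the intersection of the members selected by the block mask `s`. [this work] -/
def andMaskF (full : ℕ) (a : List ℕ) (s : ℕ) : ℕ :=
  (List.range a.length).foldl (fun acc i => if s.testBit i then acc &&& a.getD i 0 else acc) full

/-- Bits of a conditional AND-fold. [this work] -/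
theorem testBit_foldl_and (a : List ℕ) (s : ℕ) (x : ℕ) : ∀ (l : List ℕ) (init : ℕ),
    (l.foldl (fun acc i => if s.testBit i then acc &&& a.getD i 0 else acc) init).testBit x =
      (init.testBit x && l.all fun i => !s.testBit i || (a.getD i 0).testBit x) := by
  intro l
  induction l with
  | nil => intro init; simp
  | cons i l ih =>
    intro init
    rw [List.foldl_cons, ih, List.all_cons]
    by_cases hs : s.testBit i = true
    · rw [if_pos hs, Nat.testBit_land, hs]; simp [Bool.and_assoc]
    · rw [if_neg hs]; rw [Bool.not_eq_true] at hs; rw [hs]; simp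

/-- Bits of `andMaskF`. [this work] -/
theorem testBit_andMaskF (full : ℕ) (a : List ℕ) (s x : ℕ) :
    (andMaskF full a s).testBit x = (full.testBit x && (List.range a.length).all fun i => !s.testBit i || (a.getD i 0).testBit x) := by
  unfold andMaskF; rw [testBit_foldl_and]

/-- `all` of a conjunction. [this work] -/
theorem all_and_eq (l : List ℕ) (f g : ℕ → Bool) : (l.all fun i => f i && g i) = (l.all f && l.all g) := by
  induction l with
  | nil => rfl
  | cons a l ih =>
    rw [List.all_cons, List.all_cons, List.all_cons, ih]
    cases f a <;> cases g a <;> simp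

/-- **Intersections multiply**: the block `s ∪ t` selects the intersection of the two intersections. [this work] -/
theorem andMaskF_lor (full : ℕ) (a : List ℕ) (s t : ℕ) : andMaskF full a (s ||| t) = andMaskF full a s &&& andMaskF full a t := by
  refine Nat.eq_of_testBit_eq fun x => ?_
  rw [Nat.testBit_land, testBit_andMaskF, testBit_andMaskF, testBit_andMaskF]
  have e : (fun i => !(s ||| t).testBit i || (a.getD i 0).testBit x) =
      fun i => (!s.testBit i || (a.getD i 0).testBit x) && (!t.testBit i || (a.getD i 0).testBit x) := by
    funext i
    rw [Nat.testBit_lor]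
    cases s.testBit i <;> cases t.testBit i <;> simp
  rw [e, all_and_eq]
  cases full.testBit x <;> simp

/-- A singleton block selects its member (members below `full`). [this work] -/
theorem andMaskF_two_pow {full : ℕ} {a : List ℕ} (ha : ∀ x ∈ a, x &&& full = x) {i : ℕ} (hi : i < a.length) :
    andMaskF full a (2 ^ i) = a.getD i 0 := by
  have hmem : a.getD i 0 ∈ a := by rw [List.getD_eq_getElem _ _ hi]; exact List.getElem_mem hi
  refine Nat.eq_of_testBit_eq fun x => ?_
  rw [testBit_andMaskF]
  have hall : ((List.range a.length).all fun j => !(2 ^ i).testBit j || (a.getD j 0).testBit x) = (a.getD i 0).testBit x := by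
    cases hx : (a.getD i 0).testBit x
    · rw [Bool.eq_false_iff, Ne, List.all_eq_true]
      intro h
      have := h i (List.mem_range.2 hi)
      rw [Nat.testBit_two_pow_self, hx] at this
      exact Bool.false_ne_true this
    · rw [List.all_eq_true]
      intro j _
      rw [Nat.testBit_two_pow]
      by_cases hij : i = j
      · subst hij; rw [hx]; simp
      · simp [hij]
  rw [hall]
  have := congrArg (fun n => Nat.testBit n x) (ha _ hmem)
  simp only [Nat.testBit_land] at this
  rw [Bool.and_comm]
  exact this

/-- The table of the Kronecker numbers of all block intersections (index = block mask `< 2^n`; `0 ↦ 0`). [this work] -/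
def kTable (KT : ℕ → ℤ) (full : ℕ) (a : List ℕ) : Array ℤ :=
  (Array.range (2 ^ a.length)).map fun s => if s = 0 then 0 else KT (andMaskF full a s)

/-- Reading the table. [this work] -/
theorem kTable_getD (KT : ℕ → ℤ) (full : ℕ) (a : List ℕ) {s : ℕ} (hs0 : s ≠ 0) (hs : s < 2 ^ a.length) :
    (kTable KT full a).getD s 0 = KT (andMaskF full a s) := by
  unfold kTable
  have hsz : s < ((Array.range (2 ^ a.length)).map fun s => if s = 0 then (0 : ℤ) else KT (andMaskF full a s)).size := by
    rw [Array.size_map, Array.size_range]; exact hs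
  rw [Array.getD_eq_getD_getElem?, Array.getElem?_eq_getElem hsz, Option.getD_some, Array.getElem_map, Array.getElem_range, if_neg hs0]

/-! ## The recursion on block families -/

/-- Merge the block `s` into position `i` of a block family. [this work] -/
def mergeAt (s : ℕ) : List ℕ → ℕ → List ℕ
  | [], _ => []
  | t :: rest, 0 => (t ||| s) :: rest
  | t :: rest, i + 1 => t :: mergeAt s rest i

/-- `mergeAt` keeps the length. [this work] -/
theorem length_mergeAt (s : ℕ) : ∀ (l : List ℕ) (i : ℕ), (mergeAt s l i).length = l.length
  | [], _ => rfl
  | _ :: _, 0 => rfl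
  | t :: rest, i + 1 => by simp [mergeAt, length_mergeAt s rest i]

/-- Entries of `mergeAt`. [this work] -/
theorem getD_mergeAt (s : ℕ) : ∀ (l : List ℕ) (i j : ℕ), (mergeAt s l i).getD j 0 = if j = i then l.getD j 0 ||| (if i < l.length then s else 0) else l.getD j 0
  | [], i, j => by simp [mergeAt]
  | t :: rest, 0, 0 => by simp [mergeAt]
  | t :: rest, 0, j + 1 => by simp [mergeAt]
  | t :: rest, i + 1, 0 => by simp [mergeAt]
  | t :: rest, i + 1, j + 1 => by
    simp only [mergeAt, List.getD_cons_succ, getD_mergeAt s rest i j, List.length_cons, Nat.succ_lt_succ_iff,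
      Nat.succ_inj]

/-- Members of `mergeAt`: old blocks, or an old block joined with `s`. [this work] -/
theorem mem_mergeAt {s x : ℕ} : ∀ {l : List ℕ} {i : ℕ}, x ∈ mergeAt s l i → x ∈ l ∨ ∃ y ∈ l, x = y ||| s
  | [], _, h => by simp [mergeAt] at h
  | t :: rest, 0, h => by
    simp only [mergeAt, List.mem_cons] at h
    rcases h with rfl | h
    · exact Or.inr ⟨t, List.mem_cons_self, rfl⟩
    · exact Or.inl (List.mem_cons_of_mem _ h)
  | t :: rest, i + 1, h => by
    simp only [mergeAt, List.mem_cons] at h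
    rcases h with rfl | h
    · exact Or.inl List.mem_cons_self
    · rcases mem_mergeAt h with h' | ⟨y, hy, rfl⟩
      · exact Or.inl (List.mem_cons_of_mem _ h')
      · exact Or.inr ⟨y, List.mem_cons_of_mem _ hy, rfl⟩

/-- A join with a non-zero block is non-zero. [this work] -/
theorem lor_ne_zero_of_left {y s : ℕ} (hy : y ≠ 0) : y ||| s ≠ 0 := by
  intro h
  apply hy
  refine Nat.eq_of_testBit_eq fun i => ?_
  have := congrArg (fun n => Nat.testBit n i) h
  simp only [Nat.testBit_lor, Nat.zero_testBit, Bool.or_eq_false_iff] at this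
  rw [Nat.zero_testBit]; exact this.1

/-- The Lieb–Sahi recursion on block families with the tabulated Kronecker numbers `K` (specification of the memoised version). [this work] -/
def krRec (K : ℕ → ℤ) (F : ℤ) : ℕ → List ℕ → ℤ
  | 0, _ => 0
  | _ + 1, [] => 0
  | _ + 1, [s] => K s
  | fuel + 1, s :: t :: rest =>
      F * ((List.range (rest.length + 1)).map fun i => krRec K F fuel (mergeAt s (t :: rest) i)).sum
        - krRec K F fuel (t :: rest) * K s

/-- The memoised recursion (value, updated cache). [this work] -/
def krMemo (K : ℕ → ℤ) (F : ℤ) : ℕ → List ℕ → Std.HashMap (List ℕ) ℤ → ℤ × Std.HashMap (List ℕ) ℤ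
  | 0, _, c => (0, c)
  | _ + 1, [], c => (0, c)
  | _ + 1, [s], c => (K s, c)
  | fuel + 1, s :: t :: rest, c =>
      match c.get? (s :: t :: rest) with
      | some v => (v, c)
      | none =>
          let sm := (List.range (rest.length + 1)).foldl
            (fun acc i => let r := krMemo K F fuel (mergeAt s (t :: rest) i) acc.2; (acc.1 + r.1, r.2)) (0, c)
          let tl := krMemo K F fuel (t :: rest) sm.2
          (F * sm.1 - tl.1 * K s, tl.2.insert (s :: t :: rest) (F * sm.1 - tl.1 * K s))

/-- Extra fuel does not matter. [this work] -/
theorem krRec_fuel (K : ℕ → ℤ) (F : ℤ) : ∀ (fuel : ℕ) (l : List ℕ), l.length ≤ fuel → krRec K F fuel l = krRec K F l.length l := by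
  intro fuel
  induction fuel with
  | zero => intro l hl; rw [List.length_eq_zero_iff.1 (Nat.le_zero.1 hl)]; rfl
  | succ fuel ih =>
    intro l hl
    match l, hl with
    | [], _ => rfl
    | [s], _ => rfl
    | s :: t :: rest, hl =>
      simp only [List.length_cons] at hl ⊢
      show F * ((List.range (rest.length + 1)).map fun i => krRec K F fuel (mergeAt s (t :: rest) i)).sum
          - krRec K F fuel (t :: rest) * K s =
        F * ((List.range (rest.length + 1)).map fun i => krRec K F (rest.length + 1) (mergeAt s (t :: rest) i)).sum
          - krRec K F (rest.length + 1) (t :: rest) * K s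
      have h1 : ∀ i, krRec K F fuel (mergeAt s (t :: rest) i) = krRec K F (rest.length + 1) (mergeAt s (t :: rest) i) := by
        intro i
        rw [ih _ (by rw [length_mergeAt]; simp; omega), length_mergeAt]; rfl
      have h2 : krRec K F fuel (t :: rest) = krRec K F (rest.length + 1) (t :: rest) := by
        rw [ih _ (by simp; omega)]; rfl
      simp only [h1, h2]

/-- **The memoised recursion computes the recursion** and keeps the cache CORRECT (every stored value is the value of the recursion).
[this work] -/
theorem krMemo_eq (K : ℕ → ℤ) (F : ℤ) : ∀ (fuel : ℕ) (l : List ℕ) (c : Std.HashMap (List ℕ) ℤ), l.length ≤ fuel →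
    (∀ l' v, c.get? l' = some v → v = krRec K F l'.length l') →
    (krMemo K F fuel l c).1 = krRec K F l.length l ∧
      ∀ l' v, (krMemo K F fuel l c).2.get? l' = some v → v = krRec K F l'.length l' := by
  intro fuel
  induction fuel with
  | zero =>
    intro l c hl hc
    rw [List.length_eq_zero_iff.1 (Nat.le_zero.1 hl)]
    exact ⟨rfl, hc⟩
  | succ fuel ih =>
    intro l c hl hc
    match l, hl with
    | [], _ => exact ⟨rfl, hc⟩
    | [s], _ => exact ⟨rfl, hc⟩
    | s :: t :: rest, hl =>
      simp only [List.length_cons] at hl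
      have hlen : (s :: t :: rest).length = rest.length + 1 + 1 := rfl
      rw [hlen]
      unfold krMemo
      cases hget : c.get? (s :: t :: rest) with
      | some v =>
        simp only
        exact ⟨hc _ v hget, hc⟩
      | none =>
        simp only
        -- the fold over the merge positions
        have hfold : ∀ (ps : List ℕ) (acc : ℤ × Std.HashMap (List ℕ) ℤ), (∀ l' v, acc.2.get? l' = some v → v = krRec K F l'.length l') →
            ((ps.foldl (fun acc i => let r := krMemo K F fuel (mergeAt s (t :: rest) i) acc.2; (acc.1 + r.1, r.2)) acc).1 =
              acc.1 + (ps.map fun i => krRec K F (rest.length + 1) (mergeAt s (t :: rest) i)).sum) ∧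
            ∀ l' v, (ps.foldl (fun acc i => let r := krMemo K F fuel (mergeAt s (t :: rest) i) acc.2; (acc.1 + r.1, r.2)) acc).2.get? l' =
              some v → v = krRec K F l'.length l' := by
          intro ps
          induction ps with
          | nil => intro acc hacc; exact ⟨by simp, hacc⟩
          | cons i ps ihp =>
            intro acc hacc
            rw [List.foldl_cons, List.map_cons, List.sum_cons]
            obtain ⟨h1, h2⟩ := ih (mergeAt s (t :: rest) i) acc.2 (by rw [length_mergeAt, List.length_cons]; omega) hacc
            rw [length_mergeAt, List.length_cons] at h1
            obtain ⟨h3, h4⟩ := ihp (acc.1 + (krMemo K F fuel (mergeAt s (t :: rest) i) acc.2).1,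
              (krMemo K F fuel (mergeAt s (t :: rest) i) acc.2).2) h2
            refine ⟨?_, h4⟩
            refine h3.trans ?_
            rw [h1]; ring
        obtain ⟨hs1, hs2⟩ := hfold (List.range (rest.length + 1)) (0, c) hc
        obtain ⟨ht1, ht2⟩ := ih (t :: rest) _ (by rw [List.length_cons]; omega) hs2
        rw [List.length_cons] at ht1
        rw [zero_add] at hs1
        have hval : F * ((List.range (rest.length + 1)).foldl
              (fun acc i => let r := krMemo K F fuel (mergeAt s (t :: rest) i) acc.2; (acc.1 + r.1, r.2)) (0, c)).1 -
            (krMemo K F fuel (t :: rest) ((List.range (rest.length + 1)).foldl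
              (fun acc i => let r := krMemo K F fuel (mergeAt s (t :: rest) i) acc.2; (acc.1 + r.1, r.2)) (0, c)).2).1 * K s =
            krRec K F (rest.length + 1 + 1) (s :: t :: rest) := by
          rw [hs1, ht1]; rfl
        refine ⟨hval, ?_⟩
        intro l' v hv
        rw [Std.HashMap.get?_insert] at hv
        split_ifs at hv with hk
        · have hl' : l' = s :: t :: rest := (beq_iff_eq.1 hk).symm
          subst hl'
          rw [Option.some.injEq] at hv
          rw [← hv, hval]; rfl
        · exact ht2 l' v hv

/-- The empty cache is correct. [this work] -/
theorem cacheOK_empty (K : ℕ → ℤ) (F : ℤ) :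
    ∀ l' v, (∅ : Std.HashMap (List ℕ) ℤ).get? l' = some v → v = krRec K F l'.length l' := by
  intro l v hv
  simp at hv

/-- **The block-family recursion is the Lieb–Sahi recursion** on the intersections: for a block family `l` of length `k` (blocks non-zero,
`< 2^n`), `krRec` with the tabulated numbers equals `NCopyCert.sahiKr` on the family of intersections. [this work] -/
theorem krRec_eq_sahiKr (KT : ℕ → ℤ) (F : ℤ) (full : ℕ) (a : List ℕ) :
    ∀ (k : ℕ) (l : List ℕ), l.length = k → (∀ s ∈ l, s ≠ 0 ∧ s < 2 ^ a.length) →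
      krRec (fun s => (kTable KT full a).getD s 0) F k l = sahiKr KT F k (fun j : Fin k => andMaskF full a (l.getD j 0)) := by
  intro k
  induction k with
  | zero => intro l hl _; rw [List.length_eq_zero_iff.1 hl]; rfl
  | succ k ih =>
    intro l hl hbl
    match k, l, hl with
    | 0, [s], _ =>
      show (kTable KT full a).getD s 0 = KT (andMaskF full a ([s].getD 0 0))
      obtain ⟨hs0, hs⟩ := hbl s (List.mem_singleton_self s)
      rw [kTable_getD KT full a hs0 hs]; rfl
    | k + 1, s :: t :: rest, hl =>
      simp only [List.length_cons, Nat.succ_inj] at hl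
      obtain ⟨hs0, hs⟩ := hbl s List.mem_cons_self
      have hbl' : ∀ s' ∈ t :: rest, s' ≠ 0 ∧ s' < 2 ^ a.length := fun s' h => hbl s' (List.mem_cons_of_mem _ h)
      rw [sahiKr_succ_succ]
      show F * ((List.range (rest.length + 1)).map fun i =>
            krRec (fun s => (kTable KT full a).getD s 0) F (k + 1) (mergeAt s (t :: rest) i)).sum
          - krRec (fun s => (kTable KT full a).getD s 0) F (k + 1) (t :: rest) * (kTable KT full a).getD s 0 = _
      rw [kTable_getD KT full a hs0 hs, ih (t :: rest) (by rw [List.length_cons, hl]) hbl']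
      have hmerge : ∀ (i : ℕ) (hi : i < k + 1), krRec (fun s => (kTable KT full a).getD s 0) F (k + 1) (mergeAt s (t :: rest) i) =
          sahiKr KT F (k + 1) (Function.update (Fin.tail fun j : Fin (k + 2) => andMaskF full a ((s :: t :: rest).getD j 0))
            ⟨i, hi⟩ (Fin.tail (fun j : Fin (k + 2) => andMaskF full a ((s :: t :: rest).getD j 0)) ⟨i, hi⟩ &&&
              andMaskF full a ((s :: t :: rest).getD (0 : Fin (k + 2)) 0))) := by
        intro i hi
        rw [ih (mergeAt s (t :: rest) i) (by rw [length_mergeAt, List.length_cons, hl]) ?_]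
        · congr 1
          funext j
          rw [getD_mergeAt]
          simp only [Function.update_apply, Fin.tail, Fin.ext_iff, Fin.val_succ, List.length_cons, List.getD_cons_succ,
            Fin.val_zero, List.getD_cons_zero]
          by_cases hji : (j : ℕ) = i
          · rw [if_pos hji, if_pos hji, if_pos (by omega), andMaskF_lor, hji]
          · rw [if_neg hji, if_neg hji]
        · intro s' hs'
          rcases mem_mergeAt hs' with h | ⟨y, hy, rfl⟩
          · exact hbl' s' h
          · obtain ⟨hy0, hylt⟩ := hbl' y hy
            exact ⟨lor_ne_zero_of_left hy0, Nat.or_lt_two_pow hylt hs⟩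
      rw [Finset.sum_fin_eq_sum_range, ← List.toFinset_range, List.sum_toFinset _ List.nodup_range, hl]
      congr 2
      congr 1
      refine List.map_congr_left fun i hi => ?_
      rw [List.mem_range] at hi
      rw [dif_pos hi, hmerge i hi]

/-! ## The memoised digit test and its soundness -/

/-- **The memoised order-`n` digit test** of a family of member bitmasks of the `m`-cube (base `2^σb`, positions in base `n+1`), with its base
conditions; the same number as `NCopyCert.checkFamW`, computed on block families with a cache. [this work] -/
def testM (m n σb : ℕ) (a : Fin n → ℕ) : Bool :=
  decide (0 < σb) && decide (coefBound m n < 2 ^ (σb - 1)) &&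
    (let KT : ℕ → ℤ := fun T => (krTB σb (n + 1) m T : ℤ)
     let tab := kTable KT (fullN m) (List.ofFn a)
     let Z := (krMemo (fun s => tab.getD s 0) (KT (fullN m)) n ((List.range n).map fun i => 2 ^ i) ∅).1 + (maskN σb ((n + 1) ^ m) : ℤ)
     decide (0 ≤ Z) && decide ((Z.toNat &&& maskN σb ((n + 1) ^ m)) = maskN σb ((n + 1) ^ m)))

/-- The initial block family (singletons) evaluates to `sahiKr` of the members. [this work] -/
theorem krMemo_init_eq (KT : ℕ → ℤ) (F : ℤ) {full : ℕ} (n : ℕ) (a : Fin n → ℕ) (ha : ∀ i, a i &&& full = a i) :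
    (krMemo (fun s => (kTable KT full (List.ofFn a)).getD s 0) F n ((List.range n).map fun i => 2 ^ i) ∅).1 = sahiKr KT F n a := by
  have hlen : ((List.range n).map fun i => 2 ^ i).length = n := by simp
  rw [(krMemo_eq _ F n _ ∅ (le_of_eq hlen) (cacheOK_empty _ F)).1, hlen, krRec_eq_sahiKr KT F full (List.ofFn a) n _ hlen]
  · congr 1
    funext j
    rw [List.getD_eq_getElem _ _ (by rw [hlen]; exact j.isLt)]
    simp only [List.getElem_map, List.getElem_range]
    rw [andMaskF_two_pow (fun x hx => ?_) (by rw [List.length_ofFn]; exact j.isLt)]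
    · rw [List.getD_eq_getElem _ _ (by rw [List.length_ofFn]; exact j.isLt), List.getElem_ofFn]
    · obtain ⟨i, rfl⟩ := List.mem_ofFn.1 hx |>.imp fun i h => h.symm
      exact ha i
  · intro s hs
    rw [List.mem_map] at hs
    obtain ⟨i, hi, rfl⟩ := hs
    rw [List.mem_range] at hi
    refine ⟨by positivity, ?_⟩
    rw [List.length_ofFn]
    exact Nat.pow_lt_pow_right (by norm_num) hi

/-- **`testM` is sound**: a passing test on the bitmasks of a family of events of `Set (Fin m)` gives `E_n ≥ 0` for every product weight
(the hypothesis of `sahiPositive_of_symCheckT`). [this work] -/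
theorem testM_sound {m n σb : ℕ} (A : Fin n → Set (Set (Fin m))) (h : testM m n σb (fun i => encA m (A i)) = true)
    (p : Fin m → unitInterval) : 0 ≤ sahiE (bernoulliWeight p) n (fun i => ind (A i)) := by
  unfold testM at h
  simp only [Bool.and_eq_true, decide_eq_true_eq] at h
  obtain ⟨⟨hσ, hbnd⟩, hZ, hland⟩ := h
  have hfull : ∀ i, encA m (A i) &&& fullN m = encA m (A i) := by
    intro i
    refine Nat.eq_of_testBit_eq fun x => ?_
    rw [Nat.testBit_land]
    unfold fullN
    rw [Nat.testBit_two_pow_sub_one]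
    by_cases hx : x < 2 ^ m
    · simp [hx]
    · rw [Nat.testBit_lt_two_pow (lt_of_lt_of_le (encA_lt m (A i)) (Nat.pow_le_pow_right (by norm_num) (not_lt.1 hx)))]
      simp
  rw [krMemo_init_eq _ _ n _ hfull] at hZ hland
  refine sahiE_ind_nonneg_of_checkFamW hσ hbnd (fun _ => rfl) p A ?_
  unfold checkFamW
  simp only [Bool.and_eq_true, decide_eq_true_eq]
  exact ⟨hZ, hland⟩

end Summit.CriticalPhenomena.PercolationContinuityZ3.Theorems.SahiSymCube
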